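import Summits.BirchSwinnertonDyer.BirchSwinnertonDyer.Theorems.SignedLowerHalvesSprungLowerDivisibilityAtThreeColourTransfer
import HarnessLib

/-!
# Crux `SprungLowerDivisibilityAtThree` (item stmt-BirchSwinnertonDyer-19875), line `chromatic-common-zeros`, skeleton v8:
# the LEDGER DOOR for stub K_spor `stub_katoFineLowerSporadic` on the whole telescope — K_spor ⟸ F-α ∧ R_α
# (cokernel bound at the sporadic common zeros ∧ the stub on the residue `{j < k}`), with an optional exceptional set

Cell `bsd-ssimc` (host), width seat `cruxlead-stmt-BirchSwinnertonDyer-19875-w3` (gen 6) under the 19875 LEAD; `--supports`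
stmt-BirchSwinnertonDyer-19875 `--as helper`; theorems only (no `def`, no named fact); closes NO item. Companion of
`…KatoSporadicLedger.lean` (content identity `m^• = k + c^•`, pair length, the door at one prime). HONEST FRAMING: a
literal case split that RENAMES the content locus of the open stub K_spor (Kato 2004 Conj. 12.10, Eisenstein half, at the
sporadic common zeros on class X8); K_spor, K1, leaf X8 and BSD are NOT proved by anything here.

Notation at a height-one prime `𝔭` of `Λ` for the joint ♯/♭ Coleman–Kato package `I, Cs, Cf` (`Cs.Z = Cf.Z`) and a fine dual
datum `Y`: `k = ℓ_𝔭(I.H ⧸ Cs.Z)` (zeta index), `c^• = ℓ_𝔭(Λ ⧸ range C•.colMap)` (Coleman contents), `j = min(c♯, c♭)` (local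
index), `x = ℓ_𝔭 Y.X` (fine mass). The stub at `𝔭`: `k ≤ x`.

* `stub_katoFineLowerSporadic_of_ledgerDoor (hFα) (hres)`: the registered stub (skeleton v8 :153) VERBATIM from
  (hFα) «`j ≤ x` at every sporadic common zero» — the COKERNEL BOUND F-α of STUB-PLAN §3 α3, in print the composite of
  joint Coleman surjectivity off `(T)` (Sprung 2012 §7.1, Props. 7.3/7.6; Kurihara–Pollack 2007 Prop. 1.2; Lei–Sujatha 2021
  (SES-KP)), Poitou–Tate `0 → 𝐇¹ → H¹_Iw(ℚ_p, T) → X_{p^∞} → X₀ → 0` (Kato (17.13.1)) and `char tors X_{p^∞} = char(X₀)^ι`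
  (Wingberg 1989 Cor. 2.5 / Matar 2020 Thm. 1.1), to be TYPED as a Literature fact WITH the `ι` (STUB-PLAN §0bis) — here a
  displayed hypothesis whose Lean signature is the one a typer needs; and (hres) «the stub on `{j < k}`» = the residue R_α.
* `stub_katoFineLowerSporadic_of_ledgerDoor_off (S) (hFα) (hres)`: the same with an EXCEPTIONAL SET `S p γ 𝔭` of primes
  (e.g. the Tate lines `𝔭 = (1 + T − u^{±1})`, where Poitou–Tate has local `H²` terms): F-α is asked OFF `S` only and the
  residue absorbs `S`.

References: [Kato2004Asterisque] Conj. 12.10 (p. 224), Thm. 12.5/12.6 (p. 222), §17.13 with (17.13.1) (p. 280); [Sprung2012]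
§7.1, Props. 7.3/7.6, Thm. 7.14 (3) (p. 1504), Prop. 7.19 (p. 1505); [KuriharaPollack2007] Prop. 1.2, Problem 3.2;
[LeiSujatha2021] (SES-KP), Prop. 3.1; [Wingberg1989] Cor. 2.5; [Matar2020] Thm. 1.1; [Sprung2015] Conj. 5.6; tree:
`Cruxes/SprungLowerDivisibilityAtThree/STUB-PLAN-stub_katoFineLowerSporadic.md` §3 α, §4; `Lines/chromatic_common_zeros.lean` v8.
-/

set_option linter.dupNamespace false
set_option autoImplicit false

noncomputable section

open scoped Classical NumberField MatrixGroups ModularForm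

open NumberField IsDedekindDomain CongruenceSubgroup WeierstrassCurve Field
  Literature.NumberTheory.EllipticCurves Literature.NumberTheory.EllipticCurves.ModularForms
  Literature.NumberTheory.EllipticCurves.ZpExtension Literature.NumberTheory.EllipticCurves.Sprung2017
  Literature.NumberTheory.EllipticCurves.Sprung2012 Literature.NumberTheory.EllipticCurves.Rank1Residual
  Literature.NumberTheory.EllipticCurves.IwasawaAlgebra Literature.NumberTheory.EllipticCurves.Kato2004
  Literature.NumberTheory.EllipticCurves.Module
  Summit.BirchSwinnertonDyer.BirchSwinnertonDyer.Theorems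
  Summit.BirchSwinnertonDyer.BirchSwinnertonDyer.Theorems.SmallImageSignedMuDefect

namespace Summit.BirchSwinnertonDyer.BirchSwinnertonDyer.Theorems.ChromaticCommonZeros

/-! ### §4 The telescope: the registered stub from the cokernel bound F-α and the residue `{j < k}` -/

/-- **K_spor ⟸ F-α ∧ R_α (the LEDGER RESHAPE of stub `stub_katoFineLowerSporadic`, skeleton v8 :153).** Over the
stub's OWN binders (class X8, cyclotomic/Honda setting, newform and Sprung pair, the joint ♯/♭ Coleman–Kato package
`I, Cs, Cf` with `Cs.Z = Cf.Z`, a fine dual datum `Y`, a height-one `𝔭 ∌ p` containing no `ω_n` at which every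
colour's normalised `L`-function vanishes):
* (hFα) **the cokernel bound**: `min(ℓ_𝔭 Λ/range Col♯, ℓ_𝔭 Λ/range Col♭) ≤ ℓ_𝔭 Y.X` — IN PRINT as the composite of
  joint Coleman surjectivity off `(T)` (Sprung 2012 §7.1, Props. 7.3/7.6; Lei–Sujatha 2021 (SES-KP)), Poitou–Tate
  (Kato (17.13.1)) and `char tors X_{p^∞} = char(X₀)^ι` (Wingberg 1989 Cor. 2.5 / Matar 2020 Thm. 1.1), to be TYPED as a
  Literature fact WITH the `ι` (the stub's `Y` is `γ`-keyed); should the typed fact carry a further side condition at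
  `𝔭` (Tate lines), restrict (hFα) and enlarge (hres) by it — the proof below is a literal case split;
* (hres) **the residue R_α**: the stub itself on `{j < k}` («the zeta index exceeds the local index»; contains every
  simple sporadic common zero with `(k, j) = (1, 0)`; Kato's main conjecture ⊆ there; conjecturally EMPTY);
the registered stub follows VERBATIM. Nothing is discharged: (hres) is K_spor's content locus renamed, honestly SMALLER
than K_spor by exactly the door `{k ≤ j}`. [cite: Kato2004Asterisque, Conj. 12.10 (p. 224), Thm. 12.5/12.6 (p. 222), §17.13 (p. 280)]
[cite: Sprung2012, §7.1, Props. 7.3/7.6, Thm. 7.14 (3) (p. 1504), Prop. 7.19 (p. 1505)] [cite: Sprung2015, Conj. 5.6] -/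
theorem stub_katoFineLowerSporadic_of_ledgerDoor
    (hFα : ∀ (W : WeierstrassCurve ℚ) [W.IsElliptic] [W.IsGloballyMinimal] (p : ℕ) [Fact p.Prime]
      [ContinuousSMul ℤ_[p] (W.tateModule p)] [Module.Free ℤ_[p] (W.tateModule p)]
      [Module.Finite ℤ_[p] (W.tateModule p)],
      ClassX8 W p → ∀ (κ : ZpExtension ℚ p) (γ : Field.absoluteGaloisGroup ℚ),
      κ.IsCyclotomic → κ.IsTopGenerator γ → IsCyclotomicVariable p γ →
    ∀ (v : HeightOneSpectrum (𝓞 ℚ)), (p : 𝓞 ℚ) ∈ v.asIdeal →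
    ∀ (g : Field.absoluteGaloisGroup (v.adicCompletion ℚ)),
      κ.IsTopGenerator (resGalOfEmb (closureEmb (K := ℚ) (v.adicCompletion ℚ)) g) →
    ∀ (cneg : localPoints W (v.adicCompletion ℚ)) (c : ℕ → localPoints W (v.adicCompletion ℚ)),
      IsHondaSystem κ (closureEmb (K := ℚ) (v.adicCompletion ℚ)) W (W.frobeniusTrace p) g cneg c →
    ∀ (N : ℕ) (_ : NeZero N) (f : CuspForm (Gamma0 N) 2) (ϖ : ℚ) (Lsharp Lflat : IwasawaAlgebra p),
      IsNewformOf W f → (ϖ : ℝ) * W.realPeriodRat = plusPeriod f →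
      IsSprungPair f p (W.frobeniusTrace p) Lsharp Lflat →
    ∀ (I : Kato2004.IwasawaH1Data W p κ γ)
      (Cs : SharpFlatColemanKatoData W p f ϖ κ γ (closureEmb (K := ℚ) (v.adicCompletion ℚ))
        (W.frobeniusTrace p) g c Chroma.sharp I)
      (Cf : SharpFlatColemanKatoData W p f ϖ κ γ (closureEmb (K := ℚ) (v.adicCompletion ℚ))
        (W.frobeniusTrace p) g c Chroma.flat I),
      Cs.Z = Cf.Z →
    ∀ (Y : W.FineSelmerDualData κ γ) (𝔭 : PrimeSpectrum (IwasawaAlgebra p)), 𝔭.asIdeal.height = 1 →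
      (p : IwasawaAlgebra p) ∉ 𝔭.asIdeal →
      (¬ ∃ n : ℕ, ((cyclotomicOmega p n).map (Int.castRingHom ℤ_[p]) : PowerSeries ℤ_[p]) ∈ 𝔭.asIdeal) →
      (∀ (col' : Chroma) (G' : IwasawaAlgebra p),
        iwasawaToPowerSeries p G' =
          PowerSeries.C (ϖ : ℚ_[p]) * iwasawaToPowerSeries p (chromaticL col' Lsharp Lflat) →
        G' ∈ 𝔭.asIdeal) →
      min (Module.lengthAt (IwasawaAlgebra p) (IwasawaAlgebra p ⧸ LinearMap.range Cs.colMap) 𝔭)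
          (Module.lengthAt (IwasawaAlgebra p) (IwasawaAlgebra p ⧸ LinearMap.range Cf.colMap) 𝔭) ≤
        Module.lengthAt (IwasawaAlgebra p) Y.X 𝔭)
    (hres : ∀ (W : WeierstrassCurve ℚ) [W.IsElliptic] [W.IsGloballyMinimal] (p : ℕ) [Fact p.Prime]
      [ContinuousSMul ℤ_[p] (W.tateModule p)] [Module.Free ℤ_[p] (W.tateModule p)]
      [Module.Finite ℤ_[p] (W.tateModule p)],
      ClassX8 W p → ∀ (κ : ZpExtension ℚ p) (γ : Field.absoluteGaloisGroup ℚ),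
      κ.IsCyclotomic → κ.IsTopGenerator γ → IsCyclotomicVariable p γ →
    ∀ (v : HeightOneSpectrum (𝓞 ℚ)), (p : 𝓞 ℚ) ∈ v.asIdeal →
    ∀ (g : Field.absoluteGaloisGroup (v.adicCompletion ℚ)),
      κ.IsTopGenerator (resGalOfEmb (closureEmb (K := ℚ) (v.adicCompletion ℚ)) g) →
    ∀ (cneg : localPoints W (v.adicCompletion ℚ)) (c : ℕ → localPoints W (v.adicCompletion ℚ)),
      IsHondaSystem κ (closureEmb (K := ℚ) (v.adicCompletion ℚ)) W (W.frobeniusTrace p) g cneg c →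
    ∀ (N : ℕ) (_ : NeZero N) (f : CuspForm (Gamma0 N) 2) (ϖ : ℚ) (Lsharp Lflat : IwasawaAlgebra p),
      IsNewformOf W f → (ϖ : ℝ) * W.realPeriodRat = plusPeriod f →
      IsSprungPair f p (W.frobeniusTrace p) Lsharp Lflat →
    ∀ (I : Kato2004.IwasawaH1Data W p κ γ)
      (Cs : SharpFlatColemanKatoData W p f ϖ κ γ (closureEmb (K := ℚ) (v.adicCompletion ℚ))
        (W.frobeniusTrace p) g c Chroma.sharp I)
      (Cf : SharpFlatColemanKatoData W p f ϖ κ γ (closureEmb (K := ℚ) (v.adicCompletion ℚ))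
        (W.frobeniusTrace p) g c Chroma.flat I),
      Cs.Z = Cf.Z →
    ∀ (Y : W.FineSelmerDualData κ γ) (𝔭 : PrimeSpectrum (IwasawaAlgebra p)), 𝔭.asIdeal.height = 1 →
      (p : IwasawaAlgebra p) ∉ 𝔭.asIdeal →
      (¬ ∃ n : ℕ, ((cyclotomicOmega p n).map (Int.castRingHom ℤ_[p]) : PowerSeries ℤ_[p]) ∈ 𝔭.asIdeal) →
      (∀ (col' : Chroma) (G' : IwasawaAlgebra p),
        iwasawaToPowerSeries p G' =
          PowerSeries.C (ϖ : ℚ_[p]) * iwasawaToPowerSeries p (chromaticL col' Lsharp Lflat) →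
        G' ∈ 𝔭.asIdeal) →
      min (Module.lengthAt (IwasawaAlgebra p) (IwasawaAlgebra p ⧸ LinearMap.range Cs.colMap) 𝔭)
          (Module.lengthAt (IwasawaAlgebra p) (IwasawaAlgebra p ⧸ LinearMap.range Cf.colMap) 𝔭) <
        Module.lengthAt (IwasawaAlgebra p) (I.H ⧸ Cs.Z) 𝔭 →
      Module.lengthAt (IwasawaAlgebra p) (I.H ⧸ Cs.Z) 𝔭 ≤ Module.lengthAt (IwasawaAlgebra p) Y.X 𝔭) :
    ∀ (W : WeierstrassCurve ℚ) [W.IsElliptic] [W.IsGloballyMinimal] (p : ℕ) [Fact p.Prime]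
      [ContinuousSMul ℤ_[p] (W.tateModule p)] [Module.Free ℤ_[p] (W.tateModule p)]
      [Module.Finite ℤ_[p] (W.tateModule p)],
      ClassX8 W p → ∀ (κ : ZpExtension ℚ p) (γ : Field.absoluteGaloisGroup ℚ),
      κ.IsCyclotomic → κ.IsTopGenerator γ → IsCyclotomicVariable p γ →
    ∀ (v : HeightOneSpectrum (𝓞 ℚ)), (p : 𝓞 ℚ) ∈ v.asIdeal →
    ∀ (g : Field.absoluteGaloisGroup (v.adicCompletion ℚ)),
      κ.IsTopGenerator (resGalOfEmb (closureEmb (K := ℚ) (v.adicCompletion ℚ)) g) →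
    ∀ (cneg : localPoints W (v.adicCompletion ℚ)) (c : ℕ → localPoints W (v.adicCompletion ℚ)),
      IsHondaSystem κ (closureEmb (K := ℚ) (v.adicCompletion ℚ)) W (W.frobeniusTrace p) g cneg c →
    ∀ (N : ℕ) (_ : NeZero N) (f : CuspForm (Gamma0 N) 2) (ϖ : ℚ) (Lsharp Lflat : IwasawaAlgebra p),
      IsNewformOf W f → (ϖ : ℝ) * W.realPeriodRat = plusPeriod f →
      IsSprungPair f p (W.frobeniusTrace p) Lsharp Lflat →
    ∀ (I : Kato2004.IwasawaH1Data W p κ γ)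
      (Cs : SharpFlatColemanKatoData W p f ϖ κ γ (closureEmb (K := ℚ) (v.adicCompletion ℚ))
        (W.frobeniusTrace p) g c Chroma.sharp I)
      (Cf : SharpFlatColemanKatoData W p f ϖ κ γ (closureEmb (K := ℚ) (v.adicCompletion ℚ))
        (W.frobeniusTrace p) g c Chroma.flat I),
      Cs.Z = Cf.Z →
    ∀ (Y : W.FineSelmerDualData κ γ) (𝔭 : PrimeSpectrum (IwasawaAlgebra p)), 𝔭.asIdeal.height = 1 →
      (p : IwasawaAlgebra p) ∉ 𝔭.asIdeal →
      (¬ ∃ n : ℕ, ((cyclotomicOmega p n).map (Int.castRingHom ℤ_[p]) : PowerSeries ℤ_[p]) ∈ 𝔭.asIdeal) →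
      (∀ (col' : Chroma) (G' : IwasawaAlgebra p),
        iwasawaToPowerSeries p G' =
          PowerSeries.C (ϖ : ℚ_[p]) * iwasawaToPowerSeries p (chromaticL col' Lsharp Lflat) →
        G' ∈ 𝔭.asIdeal) →
      Module.lengthAt (IwasawaAlgebra p) (I.H ⧸ Cs.Z) 𝔭 ≤ Module.lengthAt (IwasawaAlgebra p) Y.X 𝔭 := by
  intro W _ _ p _ _ _ _ hX κ γ hκ hγ hcv v hv g hg cneg c hH N hN f ϖ Lsharp Lflat hf hϖ hSP I Cs Cf hZ Y 𝔭 h𝔭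
    hp𝔭 hcyc hcommon
  by_cases hkj : Module.lengthAt (IwasawaAlgebra p) (I.H ⧸ Cs.Z) 𝔭 ≤
      min (Module.lengthAt (IwasawaAlgebra p) (IwasawaAlgebra p ⧸ LinearMap.range Cs.colMap) 𝔭)
        (Module.lengthAt (IwasawaAlgebra p) (IwasawaAlgebra p ⧸ LinearMap.range Cf.colMap) 𝔭)
  · exact hkj.trans (hFα W p hX κ γ hκ hγ hcv v hv g hg cneg c hH N hN f ϖ Lsharp Lflat hf hϖ hSP I Cs Cf hZ Y 𝔭
      h𝔭 hp𝔭 hcyc hcommon)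
  · exact hres W p hX κ γ hκ hγ hcv v hv g hg cneg c hH N hN f ϖ Lsharp Lflat hf hϖ hSP I Cs Cf hZ Y 𝔭 h𝔭 hp𝔭
      hcyc hcommon (not_le.mp hkj)

/-- **K_spor ⟸ F-α off an exceptional set `S` ∧ R_α on `S ∪ {j < k}`.** As `stub_katoFineLowerSporadic_of_ledgerDoor`,
but the cokernel bound (hFα) is asked only at the sporadic common zeros `𝔭` with `¬ S p γ 𝔭`, and the residue (hres)
covers `S p γ 𝔭 ∨ j < k`. Intended `S`: the TATE LINES `𝔭 = (1 + T − κ(γ)^{±1})` (the `|m| = 1` arithmetic points, where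
the Poitou–Tate sequence behind F-α has local `H²` terms at the split multiplicative primes of `E`) — or whatever side
condition the typed Literature fact for F-α turns out to carry. A literal case split; nothing is discharged.
[cite: Kato2004Asterisque, Conj. 12.10 (p. 224), (17.13.1) (p. 280)] [cite: Sprung2012, §7.1, Props. 7.3/7.6, Thm. 7.14 (3) (p. 1504)] -/
theorem stub_katoFineLowerSporadic_of_ledgerDoor_off
    (S : ∀ (p : ℕ) [Fact p.Prime], Field.absoluteGaloisGroup ℚ → PrimeSpectrum (IwasawaAlgebra p) → Prop)
    (hFα : ∀ (W : WeierstrassCurve ℚ) [W.IsElliptic] [W.IsGloballyMinimal] (p : ℕ) [Fact p.Prime]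
      [ContinuousSMul ℤ_[p] (W.tateModule p)] [Module.Free ℤ_[p] (W.tateModule p)]
      [Module.Finite ℤ_[p] (W.tateModule p)],
      ClassX8 W p → ∀ (κ : ZpExtension ℚ p) (γ : Field.absoluteGaloisGroup ℚ),
      κ.IsCyclotomic → κ.IsTopGenerator γ → IsCyclotomicVariable p γ →
    ∀ (v : HeightOneSpectrum (𝓞 ℚ)), (p : 𝓞 ℚ) ∈ v.asIdeal →
    ∀ (g : Field.absoluteGaloisGroup (v.adicCompletion ℚ)),
      κ.IsTopGenerator (resGalOfEmb (closureEmb (K := ℚ) (v.adicCompletion ℚ)) g) →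
    ∀ (cneg : localPoints W (v.adicCompletion ℚ)) (c : ℕ → localPoints W (v.adicCompletion ℚ)),
      IsHondaSystem κ (closureEmb (K := ℚ) (v.adicCompletion ℚ)) W (W.frobeniusTrace p) g cneg c →
    ∀ (N : ℕ) (_ : NeZero N) (f : CuspForm (Gamma0 N) 2) (ϖ : ℚ) (Lsharp Lflat : IwasawaAlgebra p),
      IsNewformOf W f → (ϖ : ℝ) * W.realPeriodRat = plusPeriod f →
      IsSprungPair f p (W.frobeniusTrace p) Lsharp Lflat →
    ∀ (I : Kato2004.IwasawaH1Data W p κ γ)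
      (Cs : SharpFlatColemanKatoData W p f ϖ κ γ (closureEmb (K := ℚ) (v.adicCompletion ℚ))
        (W.frobeniusTrace p) g c Chroma.sharp I)
      (Cf : SharpFlatColemanKatoData W p f ϖ κ γ (closureEmb (K := ℚ) (v.adicCompletion ℚ))
        (W.frobeniusTrace p) g c Chroma.flat I),
      Cs.Z = Cf.Z →
    ∀ (Y : W.FineSelmerDualData κ γ) (𝔭 : PrimeSpectrum (IwasawaAlgebra p)), 𝔭.asIdeal.height = 1 →
      (p : IwasawaAlgebra p) ∉ 𝔭.asIdeal →
      (¬ ∃ n : ℕ, ((cyclotomicOmega p n).map (Int.castRingHom ℤ_[p]) : PowerSeries ℤ_[p]) ∈ 𝔭.asIdeal) →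
      (∀ (col' : Chroma) (G' : IwasawaAlgebra p),
        iwasawaToPowerSeries p G' =
          PowerSeries.C (ϖ : ℚ_[p]) * iwasawaToPowerSeries p (chromaticL col' Lsharp Lflat) →
        G' ∈ 𝔭.asIdeal) →
      ¬ S p γ 𝔭 →
      min (Module.lengthAt (IwasawaAlgebra p) (IwasawaAlgebra p ⧸ LinearMap.range Cs.colMap) 𝔭)
          (Module.lengthAt (IwasawaAlgebra p) (IwasawaAlgebra p ⧸ LinearMap.range Cf.colMap) 𝔭) ≤
        Module.lengthAt (IwasawaAlgebra p) Y.X 𝔭)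
    (hres : ∀ (W : WeierstrassCurve ℚ) [W.IsElliptic] [W.IsGloballyMinimal] (p : ℕ) [Fact p.Prime]
      [ContinuousSMul ℤ_[p] (W.tateModule p)] [Module.Free ℤ_[p] (W.tateModule p)]
      [Module.Finite ℤ_[p] (W.tateModule p)],
      ClassX8 W p → ∀ (κ : ZpExtension ℚ p) (γ : Field.absoluteGaloisGroup ℚ),
      κ.IsCyclotomic → κ.IsTopGenerator γ → IsCyclotomicVariable p γ →
    ∀ (v : HeightOneSpectrum (𝓞 ℚ)), (p : 𝓞 ℚ) ∈ v.asIdeal →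
    ∀ (g : Field.absoluteGaloisGroup (v.adicCompletion ℚ)),
      κ.IsTopGenerator (resGalOfEmb (closureEmb (K := ℚ) (v.adicCompletion ℚ)) g) →
    ∀ (cneg : localPoints W (v.adicCompletion ℚ)) (c : ℕ → localPoints W (v.adicCompletion ℚ)),
      IsHondaSystem κ (closureEmb (K := ℚ) (v.adicCompletion ℚ)) W (W.frobeniusTrace p) g cneg c →
    ∀ (N : ℕ) (_ : NeZero N) (f : CuspForm (Gamma0 N) 2) (ϖ : ℚ) (Lsharp Lflat : IwasawaAlgebra p),
      IsNewformOf W f → (ϖ : ℝ) * W.realPeriodRat = plusPeriod f →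
      IsSprungPair f p (W.frobeniusTrace p) Lsharp Lflat →
    ∀ (I : Kato2004.IwasawaH1Data W p κ γ)
      (Cs : SharpFlatColemanKatoData W p f ϖ κ γ (closureEmb (K := ℚ) (v.adicCompletion ℚ))
        (W.frobeniusTrace p) g c Chroma.sharp I)
      (Cf : SharpFlatColemanKatoData W p f ϖ κ γ (closureEmb (K := ℚ) (v.adicCompletion ℚ))
        (W.frobeniusTrace p) g c Chroma.flat I),
      Cs.Z = Cf.Z →
    ∀ (Y : W.FineSelmerDualData κ γ) (𝔭 : PrimeSpectrum (IwasawaAlgebra p)), 𝔭.asIdeal.height = 1 →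
      (p : IwasawaAlgebra p) ∉ 𝔭.asIdeal →
      (¬ ∃ n : ℕ, ((cyclotomicOmega p n).map (Int.castRingHom ℤ_[p]) : PowerSeries ℤ_[p]) ∈ 𝔭.asIdeal) →
      (∀ (col' : Chroma) (G' : IwasawaAlgebra p),
        iwasawaToPowerSeries p G' =
          PowerSeries.C (ϖ : ℚ_[p]) * iwasawaToPowerSeries p (chromaticL col' Lsharp Lflat) →
        G' ∈ 𝔭.asIdeal) →
      (S p γ 𝔭 ∨
        min (Module.lengthAt (IwasawaAlgebra p) (IwasawaAlgebra p ⧸ LinearMap.range Cs.colMap) 𝔭)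
          (Module.lengthAt (IwasawaAlgebra p) (IwasawaAlgebra p ⧸ LinearMap.range Cf.colMap) 𝔭) <
          Module.lengthAt (IwasawaAlgebra p) (I.H ⧸ Cs.Z) 𝔭) →
      Module.lengthAt (IwasawaAlgebra p) (I.H ⧸ Cs.Z) 𝔭 ≤ Module.lengthAt (IwasawaAlgebra p) Y.X 𝔭) :
    ∀ (W : WeierstrassCurve ℚ) [W.IsElliptic] [W.IsGloballyMinimal] (p : ℕ) [Fact p.Prime]
      [ContinuousSMul ℤ_[p] (W.tateModule p)] [Module.Free ℤ_[p] (W.tateModule p)]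
      [Module.Finite ℤ_[p] (W.tateModule p)],
      ClassX8 W p → ∀ (κ : ZpExtension ℚ p) (γ : Field.absoluteGaloisGroup ℚ),
      κ.IsCyclotomic → κ.IsTopGenerator γ → IsCyclotomicVariable p γ →
    ∀ (v : HeightOneSpectrum (𝓞 ℚ)), (p : 𝓞 ℚ) ∈ v.asIdeal →
    ∀ (g : Field.absoluteGaloisGroup (v.adicCompletion ℚ)),
      κ.IsTopGenerator (resGalOfEmb (closureEmb (K := ℚ) (v.adicCompletion ℚ)) g) →
    ∀ (cneg : localPoints W (v.adicCompletion ℚ)) (c : ℕ → localPoints W (v.adicCompletion ℚ)),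
      IsHondaSystem κ (closureEmb (K := ℚ) (v.adicCompletion ℚ)) W (W.frobeniusTrace p) g cneg c →
    ∀ (N : ℕ) (_ : NeZero N) (f : CuspForm (Gamma0 N) 2) (ϖ : ℚ) (Lsharp Lflat : IwasawaAlgebra p),
      IsNewformOf W f → (ϖ : ℝ) * W.realPeriodRat = plusPeriod f →
      IsSprungPair f p (W.frobeniusTrace p) Lsharp Lflat →
    ∀ (I : Kato2004.IwasawaH1Data W p κ γ)
      (Cs : SharpFlatColemanKatoData W p f ϖ κ γ (closureEmb (K := ℚ) (v.adicCompletion ℚ))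
        (W.frobeniusTrace p) g c Chroma.sharp I)
      (Cf : SharpFlatColemanKatoData W p f ϖ κ γ (closureEmb (K := ℚ) (v.adicCompletion ℚ))
        (W.frobeniusTrace p) g c Chroma.flat I),
      Cs.Z = Cf.Z →
    ∀ (Y : W.FineSelmerDualData κ γ) (𝔭 : PrimeSpectrum (IwasawaAlgebra p)), 𝔭.asIdeal.height = 1 →
      (p : IwasawaAlgebra p) ∉ 𝔭.asIdeal →
      (¬ ∃ n : ℕ, ((cyclotomicOmega p n).map (Int.castRingHom ℤ_[p]) : PowerSeries ℤ_[p]) ∈ 𝔭.asIdeal) →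
      (∀ (col' : Chroma) (G' : IwasawaAlgebra p),
        iwasawaToPowerSeries p G' =
          PowerSeries.C (ϖ : ℚ_[p]) * iwasawaToPowerSeries p (chromaticL col' Lsharp Lflat) →
        G' ∈ 𝔭.asIdeal) →
      Module.lengthAt (IwasawaAlgebra p) (I.H ⧸ Cs.Z) 𝔭 ≤ Module.lengthAt (IwasawaAlgebra p) Y.X 𝔭 := by
  intro W _ _ p _ _ _ _ hX κ γ hκ hγ hcv v hv g hg cneg c hH N hN f ϖ Lsharp Lflat hf hϖ hSP I Cs Cf hZ Y 𝔭 h𝔭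
    hp𝔭 hcyc hcommon
  by_cases hS : S p γ 𝔭
  · exact hres W p hX κ γ hκ hγ hcv v hv g hg cneg c hH N hN f ϖ Lsharp Lflat hf hϖ hSP I Cs Cf hZ Y 𝔭 h𝔭 hp𝔭
      hcyc hcommon (Or.inl hS)
  by_cases hkj : Module.lengthAt (IwasawaAlgebra p) (I.H ⧸ Cs.Z) 𝔭 ≤
      min (Module.lengthAt (IwasawaAlgebra p) (IwasawaAlgebra p ⧸ LinearMap.range Cs.colMap) 𝔭)
          (Module.lengthAt (IwasawaAlgebra p) (IwasawaAlgebra p ⧸ LinearMap.range Cf.colMap) 𝔭)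
  · exact hkj.trans (hFα W p hX κ γ hκ hγ hcv v hv g hg cneg c hH N hN f ϖ Lsharp Lflat hf hϖ hSP I Cs Cf hZ Y 𝔭
      h𝔭 hp𝔭 hcyc hcommon hS)
  · exact hres W p hX κ γ hκ hγ hcv v hv g hg cneg c hH N hN f ϖ Lsharp Lflat hf hϖ hSP I Cs Cf hZ Y 𝔭 h𝔭 hp𝔭
      hcyc hcommon (Or.inr (not_le.mp hkj))

end Summit.BirchSwinnertonDyer.BirchSwinnertonDyer.Theorems.ChromaticCommonZeros

end
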